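import Summits.AtomisticToContinuum.Crystallization.Theorems.FreeSplittingCertificatesRadiusLadderRadiusFloor
import Summits.AtomisticToContinuum.Crystallization.Theorems.FreeSplittingCertificatesRadiusLadderApprox4750

/-!
# Radius ladder for `ApproxFiniteRangeSplitting`: the `ε`-deepest-site threshold `δ_½(ε)` and the `ε`-radius floor

Route `FreeSplittingCertificates`, crux r5 `ApproxFiniteRangeSplitting` (stmt-AtomisticToContinuum-12562), the
`ε`-version of crux r2 `FiniteRangeSplitting` (stmt-AtomisticToContinuum-12559); block-2b unit `b2b-freesplit`, PART A
gen 17.  Value = structural theorems about the cruxes' instances — NOT summit progress.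

`ε`-analogue of `…RadiusLadderHalfRuleIff` / `…Threshold` / `…Critical` / `…RadiusFloor` for the `ε`-rungs
`ARungAt δ ε R` of `…RadiusLadderApprox`:

* § 1 — the `ε`-deepest-site inequality `AHalfSumFeasible δ ε` ("every site of every `δ`-separated finite
  configuration has half pair-sum `≥ e_∞ - ε`") is the half rule's `ε`-feasibility at any radius
  (`afeasible_halfRule_iff`), and BLIND `ε`-rungs are the `ε`-half rule: an `ε`-rung at `(δ, R)` forces
  `AHalfSumFeasible s ε` at every hard core `s ≥ δ`, `s > R` (`aHalfSumFeasible_of_arungAt_of_lt`, inversion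
  averaging `eInf_sub_le_half_sum_of_symmetric` on the trivial patterns); for `R < δ`, `ARungAt δ ε R ↔
  AHalfSumFeasible δ ε` (`arungAt_iff_aHalfSumFeasible_of_lt`);
* § 2 — its sharp hard-core threshold `δ_½(ε) := approxHalfSumThreshold ε = inf {δ > 0 | AHalfSumFeasible δ ε}`:
  for `ε ≥ 0` it is ATTAINED when positive (`aHalfSumFeasible_approxHalfSumThreshold`, closedness in `δ`,
  `arungAt_of_forall_gt_sep`), `AHalfSumFeasible δ ε ↔ δ_½(ε) ≤ δ` for `δ > 0` (`aHalfSumFeasible_iff_threshold_le`),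
  antitone in `ε`, `δ_½(0) = δ_½`, `δ_c(ε) ≤ δ_½(ε) ≤ δ_½`; the tree's star prices read `δ_½(ε) ≥ 47/50` for
  `ε < 2.415783e-3` (Star902), `≥ 23/25` for `ε < 2.802046e-3` (Star959), `≥ 5/6` for `ε < 1/200` (Star21); and
  `δ_½(ε) ↑ δ_½` as `ε ↓ 0` (`exists_eps_lt_approxHalfSumThreshold`, `isLUB_approxHalfSumThreshold`,
  `tendsto_approxHalfSumThreshold` — compactness in `ε`, `rungAt_iff_forall_arungAt`);
* § 3 — the **`ε`-radius floor** `ARungAt δ ε R ⟹ δ_½(ε) ≤ max δ R` (`approxHalfSumThreshold_le_max_of_arungAt`):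
  below `δ_½(ε)` every `ε`-rung reads radius `R ≥ δ_½(ε)`; hence the B-free necessity
  `exists_eps_not_arungAt` (at `δ, R < δ_½` some `ε > 0` has no `ε`-rung) and the window / one-instance forms of
  crux r5 with the floor built in (`approxFiniteRangeSplitting_iff_window_floor`,
  `approxFiniteRangeSplitting_iff_arung_two_fifths_floor`): the witnesses of crux r5 at a hard core below `δ_½`
  need radii `R ≥ δ_½(ε) → δ_½` as `ε ↓ 0`.
-/

noncomputable section

namespace Summit.AtomisticToContinuum.Crystallization.Theorems.StrictSplittingRuleBirth

open scoped BigOperators Classical Topology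
open Filter Literature.MathematicalPhysics.StatisticalMechanics

/-! ## 1. The `ε`-deepest-site inequality and blind `ε`-rungs -/

/-- **`ε`-deepest-site inequality at hard core `δ`**: every site of every `δ`-separated finite configuration has half
pair-sum `≥ e_∞ - ε`. [folklore] -/
def AHalfSumFeasible (δ ε : ℝ) : Prop :=
  ∀ (N : ℕ) (x : Fin N → EuclideanSpace ℝ (Fin 3)), Sep δ x → ∀ i : Fin N,
    eInf - ε ≤ (∑ j ∈ Finset.univ.erase i, lennardJones (dist (x i) (x j))) / 2

/-- The half rule's `ε`-feasibility is the `ε`-deepest-site inequality, at every radius. -/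
theorem afeasible_halfRule_iff (δ ε R : ℝ) : AFeasible δ ε R halfRule ↔ AHalfSumFeasible δ ε := by
  simp only [AFeasible, AHalfSumFeasible, siteE_halfRule]

/-- At `ε = 0` it is the deepest-site inequality. -/
theorem aHalfSumFeasible_zero_iff (δ : ℝ) : AHalfSumFeasible δ 0 ↔ HalfSumFeasible δ := by
  simp only [AHalfSumFeasible, HalfSumFeasible, sub_zero]

/-- Monotone in the hard core. -/
theorem aHalfSumFeasible_mono_sep {δ δ' ε : ℝ} (h : δ ≤ δ') (hf : AHalfSumFeasible δ ε) :
    AHalfSumFeasible δ' ε :=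
  fun N x hx i => hf N x (fun a b hab => h.trans (hx a b hab)) i

/-- Monotone in the tolerance. -/
theorem aHalfSumFeasible_mono_eps {δ ε ε' : ℝ} (h : ε ≤ ε') (hf : AHalfSumFeasible δ ε) :
    AHalfSumFeasible δ ε' :=
  fun N x hx i => (sub_le_sub_left h eInf).trans (hf N x hx i)

/-- The deepest-site inequality gives the `ε`-one for every `ε ≥ 0`. -/
theorem aHalfSumFeasible_of_halfSumFeasible {δ ε : ℝ} (hε : 0 ≤ ε) (h : HalfSumFeasible δ) :
    AHalfSumFeasible δ ε :=
  aHalfSumFeasible_mono_eps hε ((aHalfSumFeasible_zero_iff δ).2 h)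

/-- The `ε`-deepest-site inequality gives an `ε`-rung at EVERY radius (witness: the half rule). -/
theorem arungAt_of_aHalfSumFeasible {δ ε : ℝ} (h : AHalfSumFeasible δ ε) (R : ℝ) : ARungAt δ ε R :=
  ⟨halfRule, isRule_halfRule, (afeasible_halfRule_iff δ ε R).2 h⟩

/-- **Blind `ε`-rungs are the `ε`-half rule, on test configurations separated beyond the radius**: an `ε`-rung at
`(δ, R)` gives the `ε`-deepest-site inequality at every hard core `s ≥ δ` with `s > R`, `s > 0`. -/
theorem aHalfSumFeasible_of_arungAt_of_lt {δ ε R s : ℝ} (hs : 0 < s) (hδs : δ ≤ s) (hRs : R < s)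
    (h : ARungAt δ ε R) : AHalfSumFeasible s ε :=
  fun _ x hx i => eInf_sub_le_half_sum_of_symmetric hs (arungAt_mono_sep hδs h) x hx i
    fun _ hj => bondPattern_of_lt_sep hRs hx hj

/-- For `R < δ` (`δ > 0`): `ARungAt δ ε R ↔ AHalfSumFeasible δ ε` — the `ε`-version of
`rungAt_iff_halfSumFeasible_of_lt`. -/
theorem arungAt_iff_aHalfSumFeasible_of_lt {δ ε R : ℝ} (hδ : 0 < δ) (hR : R < δ) :
    ARungAt δ ε R ↔ AHalfSumFeasible δ ε :=
  ⟨aHalfSumFeasible_of_arungAt_of_lt hδ le_rfl hR, fun h => arungAt_of_aHalfSumFeasible h R⟩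

/-- Radius independence of `ε`-rungs below the hard core. -/
theorem arungAt_indep_of_lt {δ ε R R' : ℝ} (hδ : 0 < δ) (hR : R < δ) (hR' : R' < δ) :
    ARungAt δ ε R ↔ ARungAt δ ε R' := by
  rw [arungAt_iff_aHalfSumFeasible_of_lt hδ hR, arungAt_iff_aHalfSumFeasible_of_lt hδ hR']

/-! ## 2. The sharp `ε`-threshold `δ_½(ε)` -/

/-- The positive hard cores at which the `ε`-deepest-site inequality holds. [folklore] -/
def AHalfSet (ε : ℝ) : Set ℝ := {δ : ℝ | 0 < δ ∧ AHalfSumFeasible δ ε}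

/-- **`δ_½(ε)`**: the infimum of the positive hard cores at which the `ε`-deepest-site inequality holds. [folklore] -/
def approxHalfSumThreshold (ε : ℝ) : ℝ := sInf (AHalfSet ε)

/-- `AHalfSet ε` is an up-set of `(0, ∞)`. -/
theorem mem_aHalfSet_of_le {ε δ δ' : ℝ} (h : δ ∈ AHalfSet ε) (hle : δ ≤ δ') : δ' ∈ AHalfSet ε :=
  ⟨h.1.trans_le hle, aHalfSumFeasible_mono_sep hle h.2⟩

/-- … nonempty for `ε ≥ 0` (it contains `δ_½`) … -/
theorem aHalfSet_nonempty {ε : ℝ} (hε : 0 ≤ ε) : (AHalfSet ε).Nonempty :=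
  ⟨halfSumThreshold, halfSumThreshold_pos,
    aHalfSumFeasible_of_halfSumFeasible hε halfSumFeasible_halfSumThreshold⟩

/-- … and bounded below by `0`. -/
theorem aHalfSet_bddBelow (ε : ℝ) : BddBelow (AHalfSet ε) :=
  ⟨0, fun _ h => h.1.le⟩

/-- `0 ≤ δ_½(ε)`. -/
theorem approxHalfSumThreshold_nonneg (ε : ℝ) : 0 ≤ approxHalfSumThreshold ε := by
  by_cases hne : (AHalfSet ε).Nonempty
  · exact le_csInf hne fun _ h => h.1.le
  · rw [approxHalfSumThreshold, Set.not_nonempty_iff_eq_empty.mp hne, Real.sInf_empty]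

/-- A positive hard core satisfying the `ε`-inequality bounds `δ_½(ε)` from above. -/
theorem approxHalfSumThreshold_le_of {δ ε : ℝ} (hδ : 0 < δ) (h : AHalfSumFeasible δ ε) :
    approxHalfSumThreshold ε ≤ δ :=
  csInf_le (aHalfSet_bddBelow ε) ⟨hδ, h⟩

/-- A hard core violating the `ε`-inequality bounds `δ_½(ε)` from below (`ε ≥ 0`). -/
theorem le_approxHalfSumThreshold_of_not {c ε : ℝ} (hε : 0 ≤ ε) (hc : ¬ AHalfSumFeasible c ε) :
    c ≤ approxHalfSumThreshold ε :=
  le_csInf (aHalfSet_nonempty hε) fun _ h => not_lt.mp fun hlt => hc (aHalfSumFeasible_mono_sep hlt.le h.2)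

/-- Strictly above `δ_½(ε)` the `ε`-inequality holds (`ε ≥ 0`) … -/
theorem aHalfSumFeasible_of_threshold_lt {δ ε : ℝ} (hε : 0 ≤ ε) (h : approxHalfSumThreshold ε < δ) :
    AHalfSumFeasible δ ε := by
  by_contra hc
  exact absurd (le_approxHalfSumThreshold_of_not hε hc) (not_le.mpr h)

/-- … and strictly below it fails (positive hard cores). -/
theorem not_aHalfSumFeasible_of_lt_threshold {δ ε : ℝ} (hδ : 0 < δ) (h : δ < approxHalfSumThreshold ε) :
    ¬ AHalfSumFeasible δ ε :=
  fun hf => absurd (approxHalfSumThreshold_le_of hδ hf) (not_le.mpr h)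

/-- `δ_½(ε) ≤ δ_½` for `ε ≥ 0`. -/
theorem approxHalfSumThreshold_le_halfSumThreshold {ε : ℝ} (hε : 0 ≤ ε) :
    approxHalfSumThreshold ε ≤ halfSumThreshold :=
  approxHalfSumThreshold_le_of halfSumThreshold_pos
    (aHalfSumFeasible_of_halfSumFeasible hε halfSumFeasible_halfSumThreshold)

/-- `δ_½(0) = δ_½`. -/
theorem approxHalfSumThreshold_zero : approxHalfSumThreshold 0 = halfSumThreshold :=
  le_antisymm (approxHalfSumThreshold_le_halfSumThreshold le_rfl)
    (le_csInf (aHalfSet_nonempty le_rfl) fun δ h => halfSumThreshold_le_of ((aHalfSumFeasible_zero_iff δ).1 h.2))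

/-- `δ_½(·)` is antitone on `[0, ∞)`. -/
theorem approxHalfSumThreshold_antitone {ε ε' : ℝ} (hε : 0 ≤ ε) (h : ε ≤ ε') :
    approxHalfSumThreshold ε' ≤ approxHalfSumThreshold ε :=
  csInf_le_csInf (aHalfSet_bddBelow ε') (aHalfSet_nonempty hε)
    fun _ hδ => ⟨hδ.1, aHalfSumFeasible_mono_eps h hδ.2⟩

/-- Above `δ_½(ε)` every radius carries an `ε`-rung (`ε ≥ 0`). -/
theorem arungAt_of_approxThreshold_lt {δ ε : ℝ} (hε : 0 ≤ ε) (h : approxHalfSumThreshold ε < δ) (R : ℝ) :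
    ARungAt δ ε R :=
  arungAt_of_aHalfSumFeasible (aHalfSumFeasible_of_threshold_lt hε h) R

/-- **`δ_½(ε)` is attained** when positive (`ε ≥ 0`): closedness of the `ε`-rung region in the hard core at radius `0`
(`arungAt_of_forall_gt_sep`). -/
theorem aHalfSumFeasible_approxHalfSumThreshold {ε : ℝ} (hε : 0 ≤ ε) (hpos : 0 < approxHalfSumThreshold ε) :
    AHalfSumFeasible (approxHalfSumThreshold ε) ε :=
  (arungAt_iff_aHalfSumFeasible_of_lt hpos hpos).1
    (arungAt_of_forall_gt_sep hpos le_rfl fun _ hδ' => arungAt_of_approxThreshold_lt hε hδ' 0)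

/-- **Sharp threshold**: for `ε ≥ 0` and `δ > 0`, `AHalfSumFeasible δ ε ↔ δ_½(ε) ≤ δ`. -/
theorem aHalfSumFeasible_iff_threshold_le {δ ε : ℝ} (hε : 0 ≤ ε) (hδ : 0 < δ) :
    AHalfSumFeasible δ ε ↔ approxHalfSumThreshold ε ≤ δ := by
  refine ⟨approxHalfSumThreshold_le_of hδ, fun h => ?_⟩
  rcases h.lt_or_eq with hlt | heq
  · exact aHalfSumFeasible_of_threshold_lt hε hlt
  · rw [← heq]
    exact aHalfSumFeasible_approxHalfSumThreshold hε (heq ▸ hδ)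

/-- For `R < δ` (`δ > 0`, `ε ≥ 0`) the `ε`-rung is decided by `δ_½(ε)`: `ARungAt δ ε R ↔ δ_½(ε) ≤ δ`. -/
theorem arungAt_iff_approxThreshold_le_of_lt {δ ε R : ℝ} (hε : 0 ≤ ε) (hδ : 0 < δ) (hR : R < δ) :
    ARungAt δ ε R ↔ approxHalfSumThreshold ε ≤ δ := by
  rw [arungAt_iff_aHalfSumFeasible_of_lt hδ hR, aHalfSumFeasible_iff_threshold_le hε hδ]

/-- `δ_c(ε) ≤ δ_½(ε)`: hard cores above `δ_½(ε)` carry `ε`-rungs (`critSepApprox` of `…RadiusLadderCritical`). -/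
theorem critSepApprox_le_approxHalfSumThreshold {ε : ℝ} (hε : 0 ≤ ε) :
    critSepApprox ε ≤ approxHalfSumThreshold ε :=
  le_of_forall_gt_imp_ge_of_dense fun _ hδ =>
    critSepApprox_le_of_mem ⟨(approxHalfSumThreshold_nonneg ε).trans_lt hδ, 1, one_pos,
      arungAt_of_approxThreshold_lt hε hδ 1⟩

/-- **`δ_½(ε) ≥ 47/50` for `0 ≤ ε < 2.415783e-3`** (the price of Star902, `eps_ge_of_arungAt_47_50`). -/
theorem le_approxHalfSumThreshold_47_50 {ε : ℝ} (hε : 0 ≤ ε) (hε' : ε < 2415783 / 1000000000) :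
    (47 : ℝ) / 50 ≤ approxHalfSumThreshold ε :=
  le_approxHalfSumThreshold_of_not hε fun hf =>
    absurd (eps_ge_of_arungAt_47_50 (47 / 50) ε 0 le_rfl (by norm_num) (arungAt_of_aHalfSumFeasible hf 0))
      (not_le.mpr hε')

/-- `δ_½(ε) ≥ 23/25` for `0 ≤ ε < 2.802046e-3` (Star959, `eps_ge_of_arungAt_23_25`). -/
theorem le_approxHalfSumThreshold_23_25 {ε : ℝ} (hε : 0 ≤ ε) (hε' : ε < 1401023 / 500000000) :
    (23 : ℝ) / 25 ≤ approxHalfSumThreshold ε :=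
  le_approxHalfSumThreshold_of_not hε fun hf =>
    absurd (eps_ge_of_arungAt_23_25 (23 / 25) ε 0 le_rfl (by norm_num) (arungAt_of_aHalfSumFeasible hf 0))
      (not_le.mpr hε')

/-- `δ_½(ε) ≥ 5/6` for `0 ≤ ε < 1/200` (Star21, `eps_ge_of_arungAt_five_sixths`). -/
theorem le_approxHalfSumThreshold_five_sixths {ε : ℝ} (hε : 0 ≤ ε) (hε' : ε < 1 / 200) :
    (5 : ℝ) / 6 ≤ approxHalfSumThreshold ε :=
  le_approxHalfSumThreshold_of_not hε fun hf =>
    absurd (eps_ge_of_arungAt_five_sixths (5 / 6) ε 0 le_rfl (by norm_num) (arungAt_of_aHalfSumFeasible hf 0))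
      (not_le.mpr hε')

/-- In particular `δ_½(ε) > 0` and the threshold is attained for `0 ≤ ε < 1/200`. -/
theorem approxHalfSumThreshold_pos {ε : ℝ} (hε : 0 ≤ ε) (hε' : ε < 1 / 200) : 0 < approxHalfSumThreshold ε :=
  lt_of_lt_of_le (by norm_num) (le_approxHalfSumThreshold_five_sixths hε hε')

/-- **`δ_½(ε) ↑ δ_½` as `ε ↓ 0`**: every `δ < δ_½` lies below `δ_½(ε)` for some `ε > 0` (compactness in `ε`,
`rungAt_iff_forall_arungAt`, at radius `0`). -/
theorem exists_eps_lt_approxHalfSumThreshold {δ : ℝ} (h : δ < halfSumThreshold) :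
    ∃ ε : ℝ, 0 < ε ∧ δ < approxHalfSumThreshold ε := by
  obtain ⟨δ', hδδ', hδ't⟩ := exists_between (max_lt h halfSumThreshold_pos)
  have hδ'0 : 0 < δ' := (le_max_right δ 0).trans_lt hδδ'
  have hns : ¬ RungAt δ' 0 := not_rungAt_of_lt_threshold hδ'0 hδ't hδ'0
  rw [rungAt_iff_forall_arungAt] at hns
  push Not at hns
  obtain ⟨ε, hε, hna⟩ := hns
  exact ⟨ε, hε, ((le_max_left δ 0).trans_lt hδδ').trans_le
    (le_approxHalfSumThreshold_of_not hε.le fun hf => hna (arungAt_of_aHalfSumFeasible hf 0))⟩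

/-- `δ_½ = sup_{ε > 0} δ_½(ε)`. -/
theorem isLUB_approxHalfSumThreshold :
    IsLUB (approxHalfSumThreshold '' Set.Ioi 0) halfSumThreshold := by
  refine ⟨?_, fun b hb => not_lt.mp fun hlt => ?_⟩
  · rintro _ ⟨ε, hε, rfl⟩
    exact approxHalfSumThreshold_le_halfSumThreshold (le_of_lt hε)
  · obtain ⟨ε, hε, hbε⟩ := exists_eps_lt_approxHalfSumThreshold hlt
    exact absurd (hb ⟨ε, hε, rfl⟩) (not_le.mpr hbε)

/-- `δ_½(ε) → δ_½` as `ε ↓ 0`. -/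
theorem tendsto_approxHalfSumThreshold :
    Tendsto approxHalfSumThreshold (𝓝[>] 0) (𝓝 halfSumThreshold) := by
  refine tendsto_order.2 ⟨fun a ha => ?_, fun b hb => ?_⟩
  · obtain ⟨ε₀, hε₀, ha0⟩ := exists_eps_lt_approxHalfSumThreshold ha
    filter_upwards [Ioo_mem_nhdsGT hε₀] with ε hε
    exact ha0.trans_le (approxHalfSumThreshold_antitone hε.1.le hε.2.le)
  · filter_upwards [self_mem_nhdsWithin] with ε hε
    exact (approxHalfSumThreshold_le_halfSumThreshold (le_of_lt hε)).trans_lt hb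

/-! ## 3. The `ε`-radius floor and crux r5 -/

/-- **`ε`-radius floor.**  An `ε`-rung at `(δ, R)` with `δ > 0` has `δ_½(ε) ≤ max δ R`. -/
theorem approxHalfSumThreshold_le_max_of_arungAt {δ ε R : ℝ} (hδ : 0 < δ) (h : ARungAt δ ε R) :
    approxHalfSumThreshold ε ≤ max δ R :=
  le_of_forall_gt_imp_ge_of_dense fun s hs =>
    have hs0 : 0 < s := hδ.trans_le ((le_max_left δ R).trans hs.le)
    approxHalfSumThreshold_le_of hs0 (aHalfSumFeasible_of_arungAt_of_lt hs0 ((le_max_left δ R).trans hs.le)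
      ((le_max_right δ R).trans_lt hs) h)

/-- Contrapositive: with hard core and radius both below `δ_½(ε)` there is no `ε`-rung. -/
theorem not_arungAt_of_lt_approxThreshold_of_lt {δ ε R : ℝ} (hδ : 0 < δ) (hδt : δ < approxHalfSumThreshold ε)
    (hRt : R < approxHalfSumThreshold ε) : ¬ ARungAt δ ε R :=
  fun h => absurd (approxHalfSumThreshold_le_max_of_arungAt hδ h) (not_le.mpr (max_lt hδt hRt))

/-- **Below `δ_½(ε)` every `ε`-rung reads radius `R ≥ δ_½(ε)`.** -/
theorem approxThreshold_le_radius_of_arungAt {δ ε R : ℝ} (hδ : 0 < δ) (hδt : δ < approxHalfSumThreshold ε)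
    (h : ARungAt δ ε R) : approxHalfSumThreshold ε ≤ R :=
  not_lt.mp fun hRt => not_arungAt_of_lt_approxThreshold_of_lt hδ hδt hRt h

/-- Dichotomy form: an `ε`-rung at `(δ, R)`, `δ > 0`, has `δ ≥ δ_½(ε)` or `R ≥ δ_½(ε)`. -/
theorem approxThreshold_le_or_of_arungAt {δ ε R : ℝ} (hδ : 0 < δ) (h : ARungAt δ ε R) :
    approxHalfSumThreshold ε ≤ δ ∨ approxHalfSumThreshold ε ≤ R :=
  (le_or_gt (approxHalfSumThreshold ε) δ).imp_right fun hlt => approxThreshold_le_radius_of_arungAt hδ hlt h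

/-- The `ε`-rung region, decided off the half-strip `{δ < δ_½(ε) ≤ R}` (`ε ≥ 0`, `δ > 0`): `ARungAt δ ε R` holds at
every radius if `δ > δ_½(ε)` (or `δ = δ_½(ε) > 0`), and fails if `max δ R < δ_½(ε)`. -/
theorem arungAt_decided_floor {δ ε : ℝ} (hε : 0 ≤ ε) (hδ : 0 < δ) (R : ℝ) :
    (approxHalfSumThreshold ε ≤ δ → ARungAt δ ε R) ∧
      (δ < approxHalfSumThreshold ε → R < approxHalfSumThreshold ε → ¬ ARungAt δ ε R) :=
  ⟨fun h => arungAt_of_aHalfSumFeasible ((aHalfSumFeasible_iff_threshold_le hε hδ).2 h) R,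
    not_arungAt_of_lt_approxThreshold_of_lt hδ⟩

/-- **B-free necessity for crux r5 witnesses**: at a hard core `δ < δ_½` and a radius `R < δ_½`, SOME tolerance
`ε > 0` admits no `ε`-rung at `(δ, R)` — the radii of r5's witnesses at `δ` must exceed every `R < δ_½` once `ε` is
small. -/
theorem exists_eps_not_arungAt {δ R : ℝ} (hδ : 0 < δ) (hδt : δ < halfSumThreshold) (hRt : R < halfSumThreshold) :
    ∃ ε : ℝ, 0 < ε ∧ ∀ ε' : ℝ, ε' ≤ ε → ¬ ARungAt δ ε' R := by
  obtain ⟨ε, hε, hlt⟩ := exists_eps_lt_approxHalfSumThreshold (max_lt hδt hRt)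
  refine ⟨ε, hε, fun ε' hε' h => ?_⟩
  exact not_arungAt_of_lt_approxThreshold_of_lt hδ ((le_max_left δ R).trans_lt hlt)
    ((le_max_right δ R).trans_lt hlt) (arungAt_mono_eps hε' h)

/-- Equivalently: the radii carrying `ε`-rungs for ALL `ε > 0` at a hard core `δ < δ_½` are `≥ δ_½`. -/
theorem threshold_le_radius_of_forall_arungAt {δ R : ℝ} (hδ : 0 < δ) (hδt : δ < halfSumThreshold)
    (h : ∀ ε : ℝ, 0 < ε → ARungAt δ ε R) : halfSumThreshold ≤ R :=
  threshold_le_radius_of_rungAt hδ hδt (rungAt_iff_forall_arungAt.2 h)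

/-- **Window form of crux r5, floor version** (`ε`-analogue of `finiteRangeSplitting_iff_window_floor`):
`ApproxFiniteRangeSplitting ↔ ∀ ε > 0, ∀ δ ∈ (0, δ_½(ε)), ∃ R ≥ δ_½(ε), ARungAt δ ε R` — above `δ_½(ε)` the half rule
is an `ε`-rung at every radius, at `δ_½(ε)` the threshold is attained, and below it no radius `< δ_½(ε)` can work. -/
theorem approxFiniteRangeSplitting_iff_window_floor :
    Summit.AtomisticToContinuum.Crystallization.Theses.FreeSplittingCertificates.ApproxFiniteRangeSplitting ↔
      ∀ ε : ℝ, 0 < ε → ∀ δ : ℝ, 0 < δ → δ < approxHalfSumThreshold ε →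
        ∃ R : ℝ, approxHalfSumThreshold ε ≤ R ∧ ARungAt δ ε R := by
  rw [approxFiniteRangeSplitting_iff_arung]
  constructor
  · intro h ε hε δ hδ hlt
    obtain ⟨R, -, hr⟩ := h δ hδ ε hε
    exact ⟨R, approxThreshold_le_radius_of_arungAt hδ hlt hr, hr⟩
  · intro h δ hδ ε hε
    rcases lt_or_ge δ (approxHalfSumThreshold ε) with hlt | hle
    · obtain ⟨R, hR, hr⟩ := h ε hε δ hδ hlt
      exact ⟨R, hδ.trans_le (hlt.le.trans hR), hr⟩
    · exact ⟨1, one_pos, arungAt_of_aHalfSumFeasible ((aHalfSumFeasible_iff_threshold_le hε.le hδ).2 hle) 1⟩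

/-- One-instance form of crux r5 with the floor (`…HardCoreLadder`, `approxFiniteRangeSplitting_iff_arung_two_fifths`):
`ApproxFiniteRangeSplitting ↔ ∀ ε ∈ (0, 1/200), ∃ R ≥ δ_½(ε), ARungAt (2/5) ε R` (for `ε < 1/200`, `2/5 < 5/6 ≤ δ_½(ε)`). -/
theorem approxFiniteRangeSplitting_iff_arung_two_fifths_floor :
    Summit.AtomisticToContinuum.Crystallization.Theses.FreeSplittingCertificates.ApproxFiniteRangeSplitting ↔
      ∀ ε : ℝ, 0 < ε → ε < 1 / 200 → ∃ R : ℝ, approxHalfSumThreshold ε ≤ R ∧ ARungAt (2 / 5) ε R := by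
  rw [approxFiniteRangeSplitting_iff_arung_two_fifths]
  constructor
  · intro h ε hε hε'
    obtain ⟨R, -, hr⟩ := h ε hε
    exact ⟨R, approxThreshold_le_radius_of_arungAt (by norm_num)
      (lt_of_lt_of_le (by norm_num) (le_approxHalfSumThreshold_five_sixths hε.le hε')) hr, hr⟩
  · intro h ε hε
    have h1 : (0 : ℝ) < min ε (1 / 400) := lt_min hε (by norm_num)
    have h2 : min ε (1 / 400) < (1 : ℝ) / 200 := lt_of_le_of_lt (min_le_right _ _) (by norm_num)
    obtain ⟨R, hR, hr⟩ := h (min ε (1 / 400)) h1 h2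
    exact ⟨R, (approxHalfSumThreshold_pos h1.le h2).trans_le hR, arungAt_mono_eps (min_le_left _ _) hr⟩

end Summit.AtomisticToContinuum.Crystallization.Theorems.StrictSplittingRuleBirth

end
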